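import Mathlib
import Summits.NavierStokesRegularity.NavierStokesRegularity.Theorems.TaoLadderRungTwoBreakOneShiftWindowField
import Literature.Analysis.ODE.GlobalExistence
import HarnessLib

/-!
# The one-shift window system, II: EXISTENCE OF THE WINDOW RUN on the whole flight from an a priori bound,
# and the `WindowRun` packaging (cell harvest/h2-tao-ladder, seat p2; the `Φ`-part of the window certificate
# `OneShiftWindowCert` of module …OneShiftMapDefs, rung1/RUNG1-P2G9-REPORT.md §37/§40; support for
# K1(1) = `NoSurvivingDSSOne`, stmt-NavierStokesRegularity-20205)

MODEL lattice ODEs only (Tao 2016 §4 normal form on Tao's shift set `S`); nothing here is a statement about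
the Navier–Stokes equations; no item is closed.

* `exists_windowSolution_of_apriori` — CONTINUATION: if every solution of the window system (module
  …OneShiftWindowField) from `encode y` on every `[0, s] ⊆ [0, τ_hi]` obeys an a priori sup bound `R`, a
  solution exists on the whole flight (`Literature.Analysis.ODE.solution_extend`: Picard–Lindelöf on
  consecutive uniform steps + gluing, with the Lipschitz / size / continuity estimates of part I);
* `windowRun_familyOf` — such a solution, re-assembled with the tails, IS a
  `CertificateGlueOn.WindowRun shiftSet ε₀ α 0 (W-1) Eb Et τ_hi` (edge bounds from `|tubeC| + tubeR ≤ Eb / Et`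
  at the two edge shells), and `familyOf_init`: it starts at `y` on the window.

Remark (why continuation and not one Picard–Lindelöf step, pace RUNG1-P2G9-REPORT §40(a)): at the front shells
the linearised growth over one flight is `≈ e^{16…20}` (the shell ahead of the front is filled from `1e-8` to
`O(0.1)` in one flight), so no single invariant ball exists over `[0, τ_hi]`; the window ENERGY, on the other
hand, moves only through the two edge bonds (sequel …OneShiftWindowEnergy supplies the a priori bound).
-/

noncomputable section

-- the sub-problem namespace repeats the summit name by design (D-0017)
set_option linter.dupNamespace false

namespace Summit.NavierStokesRegularity.NavierStokesRegularity.Theorems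

namespace DSSOneShift

open Set Metric Filter Topology Literature.Analysis.FluidPDE Literature.Analysis.FluidPDE.TaoCascade
  CertificateGlueOn
open scoped NNReal

variable {m : ℕ}

namespace OneShiftFrame

variable (F : OneShiftFrame m)

/-! ### Existence on the whole flight from an a priori bound -/

/-- **CONTINUATION ⇒ THE WINDOW RUN EXISTS ON THE WHOLE FLIGHT.** Let `ε₀ ≥ 0`, admissible data `(y, T)`,
and suppose every solution of the window system from `encode y` on any `[0, s] ⊆ [0, τ_hi]` obeys the a
priori bound `‖β(t)‖ ≤ R`. Then a solution on `[0, τ_hi]` from `encode y` exists.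
[cite: Teschl2012, Cor. 2.16 (continuation from an a priori bound); Tao2016AveragedNS, §4 Lemma 4.1 (4.8)] -/
theorem exists_windowSolution_of_apriori {ε₀ : ℝ} (hε : 0 ≤ ε₀)
    (α : Fin m → Fin m → Fin m → ℤ × ℤ × ℤ → ℝ) {y : Fin m → ℤ → ℝ} {T : Fin m → ℤ → ℝ → ℝ}
    (hyT : F.AdmData y T) {R : ℝ} (hR : 0 ≤ R)
    (hapriori : ∀ s ∈ Icc 0 F.τhi, ∀ β : ℝ → F.WState,
      (∀ t ∈ Icc 0 s, HasDerivWithinAt β (F.wfield ε₀ α T t (β t)) (Icc 0 s) t) → β 0 = F.encode y →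
      ∀ t ∈ Icc 0 s, ‖β t‖ ≤ R) :
    ∃ β : ℝ → F.WState, β 0 = F.encode y ∧
      ∀ t ∈ Icc 0 F.τhi, HasDerivWithinAt β (F.wfield ε₀ α T t (β t)) (Icc 0 F.τhi) t := by
  have hρ : 0 ≤ R + 1 := by linarith
  have hTt : ∀ t ∈ Icc 0 F.τhi, ∀ i k, ¬ F.InWindow k → |T i k t - F.tubeC i k| ≤ F.tubeR k :=
    fun t ht i k hk => hyT.2.2 i k hk t ht
  obtain ⟨β, hβ, hβ0⟩ := Literature.Analysis.ODE.solution_extend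
    (v := fun t x => F.wfield ε₀ α T t x) (a := 0) (b := 0) (T := F.τhi) le_rfl F.τhi_pos.le
    (Literature.Analysis.ODE.solution_const (fun t x => F.wfield ε₀ α T t x) 0 (F.encode y)) (R := R)
    (K := F.lipConst ε₀ α (R + 1)) (L := F.supConst ε₀ α (R + 1))
    (fun t ht => F.lipschitzOnWith_wfield hε α (hTt t ht) hρ)
    (fun x _ => F.continuousOn_wfield ε₀ α hyT.2.1 x)
    (fun t ht x hx => F.norm_wfield_le hε α (hTt t ht) hρ hx)
    (fun s hs β hβ hβ0 t ht => hapriori s ⟨hs.1, hs.2⟩ β hβ (hβ0 (left_mem_Icc.2 le_rfl)) t ht)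
  exact ⟨β, hβ0 (left_mem_Icc.2 le_rfl), hβ⟩

/-! ### The re-assembled solution is a window run -/

/-- **A window solution, re-assembled with the tails, is a `WindowRun` on the flight** (window equations
on `[0, W-1]`, the two edge shells continuous and bounded by `Eb`, `Et` — the latter from
`|tubeC| + tubeR ≤ Eb / Et` at the edge shells), with the prescribed start on the window and the tails off it.
[cite: Tao2016AveragedNS, §4 Lemma 4.1 (4.8); cell vocabulary, window-truncated with edge inputs, harvest/h2-tao-ladder rung1/KERNEL-STAGE3-PLAN.md §2] -/
theorem windowRun_familyOf {ε₀ : ℝ} (α : Fin m → Fin m → Fin m → ℤ × ℤ × ℤ → ℝ)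
    {y : Fin m → ℤ → ℝ} {T : Fin m → ℤ → ℝ → ℝ} (hyT : F.AdmData y T)
    (hEb : ∀ i, |F.tubeC i (-1)| + F.tubeR (-1) ≤ F.Eb)
    (hEt : ∀ i, |F.tubeC i F.W| + F.tubeR F.W ≤ F.Et) {β : ℝ → F.WState}
    (hβ : ∀ t ∈ Icc 0 F.τhi, HasDerivWithinAt β (F.wfield ε₀ α T t (β t)) (Icc 0 F.τhi) t) :
    WindowRun shiftSet ε₀ α 0 ((F.W : ℤ) - 1) F.Eb F.Et F.τhi (F.familyOf β T) where
  deriv i k hk1 hk2 u hu := by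
    have hk : F.InWindow k := ⟨by omega, by omega⟩
    rw [F.familyOf_of_mem i hk]
    have h1 : HasDerivWithinAt (fun s => β s i (F.widx hk)) (F.wfield ε₀ α T u (β u) i (F.widx hk))
        (Icc 0 F.τhi) u :=
      (hasDerivWithinAt_pi.1 ((hasDerivWithinAt_pi.1 (hβ u hu)) i)) (F.widx hk)
    have h2 : F.wfield ε₀ α T u (β u) i (F.widx hk) =
        quadTermOn shiftSet ε₀ α (F.familyOf β T) i k u := by
      rw [quadTermOn_shiftSet, ← F.quadTerm_familyOf β T i (F.widx hk) u, F.natCast_widx hk]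
    rwa [h2] at h1
  cont_bot i := by
    have hk : ¬ F.InWindow (-(0 : ℤ) - 1) := by unfold InWindow; omega
    rw [F.familyOf_of_not i hk]
    exact hyT.2.1 i _ hk
  cont_top i := by
    have hk : ¬ F.InWindow ((F.W : ℤ) - 1 + 1) := by unfold InWindow; omega
    rw [F.familyOf_of_not i hk]
    exact hyT.2.1 i _ hk
  bound_bot i u hu := by
    have hk : ¬ F.InWindow (-(0 : ℤ) - 1) := by unfold InWindow; omega
    rw [F.familyOf_of_not i hk]
    have e : (-(0 : ℤ) - 1) = -1 := by norm_num
    rw [e] at hk ⊢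
    have h1 := hyT.2.2 i (-1) hk u hu
    have h3 : |T i (-1) u| ≤ |T i (-1) u - F.tubeC i (-1)| + |F.tubeC i (-1)| := by
      have := abs_add_le (T i (-1) u - F.tubeC i (-1)) (F.tubeC i (-1)); simpa using this
    linarith [hEb i]
  bound_top i u hu := by
    have hk : ¬ F.InWindow ((F.W : ℤ) - 1 + 1) := by unfold InWindow; omega
    rw [F.familyOf_of_not i hk]
    have e : ((F.W : ℤ) - 1 + 1) = F.W := by ring
    rw [e] at hk ⊢
    have h1 := hyT.2.2 i F.W hk u hu
    have h3 : |T i F.W u| ≤ |T i F.W u - F.tubeC i F.W| + |F.tubeC i F.W| := by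
      have := abs_add_le (T i F.W u - F.tubeC i F.W) (F.tubeC i F.W); simpa using this
    linarith [hEt i]

/-- The re-assembled family starts at `y` on the window when `β(0) = encode y`. [folklore] -/
theorem familyOf_init {β : ℝ → F.WState} {T : Fin m → ℤ → ℝ → ℝ} {y : Fin m → ℤ → ℝ}
    (hβ0 : β 0 = F.encode y) (i : Fin m) {k : ℤ} (hk : F.InWindow k) :
    F.familyOf β T i k 0 = y i k := by
  simp [familyOf, hk, hβ0, encode, F.natCast_widx hk]

end OneShiftFrame

end DSSOneShift

end Summit.NavierStokesRegularity.NavierStokesRegularity.Theorems
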